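import Literature.AnabelianGeometry.SemiGraphs.ThetaRayDeepFixedProjection
import HarnessLib

/-!
# The frame induction at `𝒢_θ(p,n)` for an ARBITRARY element and an arbitrary co-framed family
# (typed-form audit of [SemiAnbd] Thm 3.7 (iv) clause 2 at `𝒢_θ`, row «B9-GENERAL-PAIR», step (GP-2))

Mochizuki, *Semi-graphs of anabelioids*, Publ. RIMS **42** (2006), §3, Theorem 3.7 (iii)/(iv) pp. 40–41,
Lemma 1.8 (ii) p. 20, Remark 2.2.1 p. 24 [cite: MochizukiSemiAnbd2006, Thm 3.7(iv) p.41].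

PROOF-ONLY file (abc-iut cell, layer L3, seat abc-iut-L3-d4 gen 7; row «B9-GENERAL-PAIR@𝒢_θ» (L3-lead γ61);
frontier / erratum-grade label — typed-form audit of the cell's ∀-countable typing of Thm 3.7 (iv) at the
countermodel `𝒢_θ(p,n)`, OUTSIDE the [IUTchIII] Cor. 3.12 cone; 0 definitions, no named fact).  This is the
GENERALISATION of abc-iut-L3-d4 gen 5's bricks K-B4b/1–2 (`thetaRayFreeProP_frame_step` /
`thetaRayFreeProP_frame_induction`, written for the powers `c^{p^m}` of the escaping element `c` and the frame
of `c` itself) to an ARBITRARY element `g` of `π₁^temp(𝒢_θ)` and an arbitrary FAMILY `K` of elements sharing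
`g`'s frame branch at the shallow level:

the invariant at a vertex `P.vertex N'` of the deep tree (point sequence `P` over the vertex `w` of the ray,
branch `b` at `w`):  (I1) `ρ_{N'}(g) = σ_{N'}^{b_*(λ)}` with `‖p^m‖ ≤ ‖λ‖`;  (I2_K) for every `k ∈ K`,
`ρ_{n₀}(k) = σ_{n₀}^{b_*(u_k)}` for some `u_k` (the SAME branch `b`).  The exponent `m` is no longer read off
a power of a generator: it is the DEFECT `e₀ - a` of the order `p^a` of `ρ_{n₀}(g)` against the common order
`p^{e₀}` of the far branch generators at the shallow level `n₀` (hypothesis `hfarord`), and the order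
bookkeeping is the elementary `PadicInt.norm_pow_le_norm_of_orderOf_eq` (a frame value of order `p^{e₀-m}` has
parameter of valuation `≤ m`).

* `thetaRayFreeProP_frame_step_gen` — the invariant transports across a `g`-fixed branch (abc-iut-L3-d4's
  transport p473740, frame shift p471798, twist congruence p478571), at far vertices;
* `thetaRayFreeProP_frame_induction_gen` — hence along every `g`-fixed path of the deep tree all of whose
  vertices are far for `n₀`.

Consumers: the general (♦) «deep `g`-fixed vertices project onto `K`-fixed vertices» and the general-pair
theorem of Thm 3.7 (iv) clause 2 at `𝒢_θ` (next file).  Nothing of [SemiAnbd] is asserted; nothing bears on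
[IUTchIII] Cor. 3.12; typed ≠ proved.
-/

noncomputable section

namespace Literature.AnabelianGeometry.SemiGraphs

open CategoryTheory Filter Topology Multiplicative
open ProfiniteSemiGraph ProfiniteSemiGraph.GaloisLevelData
open Literature.AnabelianGeometry.SemiGraphs.FreeProPRankTwo

/-! ### The order bookkeeping, order form -/

/-- **Frame values of order `p^{e-m}` have parameters of valuation `≤ m`**: for a homomorphism `φ : ℤ_p → Q`
(multiplicative notation) with values in `⟨φ 1⟩`, `orderOf (φ 1) = p^e`, `m < e` and `orderOf (φ λ) = p^{e-m}`,
one has `‖p^m‖ ≤ ‖λ‖`. [cite: RibesZalesskii2010, §2.3] -/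
theorem PadicInt.norm_pow_le_norm_of_orderOf_eq {Q : Type*} [Group Q] (p : ℕ) [hp : Fact p.Prime]
    (φ : Multiplicative ℤ_[p] →* Q) (hz : ∀ t, φ t ∈ Subgroup.zpowers (φ (ofAdd 1))) {e : ℕ}
    (he : orderOf (φ (ofAdd 1)) = p ^ e) (m : ℕ) (hm : m < e) (l : Multiplicative ℤ_[p])
    (hl : orderOf (φ l) = p ^ (e - m)) :
    ‖(p : ℤ_[p]) ^ m‖ ≤ ‖l.toAdd‖ := by
  have hp1 : 1 < p := hp.out.one_lt
  by_contra hlt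
  push Not at hlt
  -- then `‖λ‖ ≤ p^{-(m+1)}`, so `λ = μ · p^(m+1)`
  have hle : ‖l.toAdd‖ ≤ (p : ℝ) ^ (-((m + 1 : ℕ) : ℤ)) := by
    rw [PadicInt.norm_le_pow_iff_norm_lt_pow_add_one]
    have : (-((m + 1 : ℕ) : ℤ)) + 1 = -(m : ℤ) := by push_cast; ring
    rw [this]
    have h2 : ‖(p : ℤ_[p]) ^ m‖ = (p : ℝ) ^ (-(m : ℤ)) := by
      rw [norm_pow, PadicInt.norm_p, zpow_neg, zpow_natCast, inv_pow]
    rw [← h2]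
    exact hlt
  rw [PadicInt.norm_le_pow_iff_mem_span_pow] at hle
  obtain ⟨μ, hμ⟩ := Ideal.mem_span_singleton'.mp hle
  -- `φ λ = η ^ p^(m+1)` with `η = φ μ ∈ ⟨φ 1⟩`, so its order is at most `p^(e-m-1)`
  have hlμ : l = (ofAdd μ) ^ p ^ (m + 1) := by
    rw [← ofAdd_nsmul, nsmul_eq_mul, Nat.cast_pow, mul_comm, hμ, ofAdd_toAdd]
  have hη : orderOf (φ (ofAdd μ)) ∣ p ^ e := he ▸ orderOf_dvd_of_mem_zpowers (hz (ofAdd μ))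
  have hpow : (φ l) ^ p ^ (e - m - 1) = 1 := by
    rw [hlμ, map_pow, ← pow_mul, ← pow_add]
    have : m + 1 + (e - m - 1) = e := by omega
    rw [this]
    exact orderOf_dvd_iff_pow_eq_one.mp hη
  have hdvd : orderOf (φ l) ∣ p ^ (e - m - 1) := orderOf_dvd_of_pow_eq_one hpow
  have hle' : orderOf (φ l) ≤ p ^ (e - m - 1) := Nat.le_of_dvd (pow_pos hp.out.pos _) hdvd
  rw [hl] at hle'
  exact absurd hle' (not_le.mpr (Nat.pow_lt_pow_right hp1 (by omega)))

namespace ProfiniteSemiGraph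

variable (p : ℕ) [hp : Fact p.Prime] (n : ℕ → ℕ)

/-! ### The general frame step -/

/-- **THE GENERAL INDUCTION STEP** (see the module docstring): the invariant (I1) for `g` at the deep level
`N'` with `‖p^m‖ ≤ ‖λ‖`, and (I2_K) for the family `K` at the shallow level `n₀` on the same branch, transport
across a `g`-fixed branch `β` at `P.vertex N'` (a far vertex: twists trivial mod `G(d)` from `k₁` on, far
branch generators of order `p^{e₀}` from `F₀` on; `ρ_{n₀}(g)` of order `p^{e₀-m}`, `m < e₀`).
[cite: MochizukiSemiAnbd2006, Thm 3.7(iv) p.41] -/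
theorem thetaRayFreeProP_frame_step_gen (h36 : (thetaRayFreeProP p n).Prop36Hypotheses)
    (g : ((thetaRayFreeProP p n).galoisLevelData h36).temperedPi h36.isCountable)
    (K : Set (((thetaRayFreeProP p n).galoisLevelData h36).temperedPi h36.isCountable))
    (m N' : ℕ) {n₀ : ℕ} (hnN : n₀ ≤ N') (e₀ : ℕ) (hm : m < e₀)
    (horder : orderOf (((thetaRayFreeProP p n).galoisLevelData h36).proj h36.isCountable n₀ g) = p ^ (e₀ - m))
    (d : ℕ)
    (hV : ∀ (w : ℕ) (P : ((thetaRayFreeProP p n).galoisLevelData h36).PointSeq h36.isCountable w) (v : Grp p),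
      v ∈ charOpenCore (Grp p) d → P.gal n₀ v = 1)
    (k₁ : ℕ) (htwist : ∀ k, k₁ ≤ k → ∀ x : Grp p, θ p (n k) x * x⁻¹ ∈ charOpenCore (Grp p) d)
    (F₀ : ℕ) (hfarord : ∀ w, F₀ ≤ w → ∀ (b : ℕ × Bool) (hb : SemiGraph.ray.abuts b = some w)
      (P : ((thetaRayFreeProP p n).galoisLevelData h36).PointSeq h36.isCountable w),
      orderOf (P.gal n₀ ((thetaRayFreeProP p n).brHom b w hb (ofAdd (1 : ℤ_[p])))) = p ^ e₀)
    (hshift : ∀ (w : ℕ) (P : ((thetaRayFreeProP p n).galoisLevelData h36).PointSeq h36.isCountable w)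
      (b₁ b₂ : ℕ × Bool) (hb₁ : SemiGraph.ray.abuts b₁ = some w) (hb₂ : SemiGraph.ray.abuts b₂ = some w)
      (f₁ f₂ y₁ y₂ : Grp p) (k k₂ : Multiplicative ℤ_[p]), ‖(p : ℤ_[p]) ^ m‖ ≤ ‖k₂.toAdd‖ →
      y₁ = (thetaRayFreeProP p n).brHom b₁ w hb₁ k → y₂ = (thetaRayFreeProP p n).brHom b₂ w hb₂ k₂ →
      P.gal N' (f₁ * y₁ * f₁⁻¹) = P.gal N' (f₂ * y₂ * f₂⁻¹) →
      ∃ (π : Multiplicative ℤ_[p]) (y v : Grp p), y = (thetaRayFreeProP p n).brHom b₂ w hb₂ π ∧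
        v ∈ charOpenCore (Grp p) d ∧ f₂⁻¹ * f₁ = y * v)
    {w : ℕ} (hw₁ : k₁ ≤ w) (hw₂ : F₀ ≤ w)
    (P : ((thetaRayFreeProP p n).galoisLevelData h36).PointSeq h36.isCountable w)
    (b : ℕ × Bool) (hb : SemiGraph.ray.abuts b = some w) (l : Multiplicative ℤ_[p]) (y : Grp p)
    (hy : y = (thetaRayFreeProP p n).brHom b w hb l) (hl : ‖(p : ℤ_[p]) ^ m‖ ≤ ‖l.toAdd‖)
    (hI1 : ((thetaRayFreeProP p n).galoisLevelData h36).proj h36.isCountable N' g = P.gal N' y)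
    (hI2 : ∀ k ∈ K, ∃ u : Multiplicative ℤ_[p],
      ((thetaRayFreeProP p n).galoisLevelData h36).proj h36.isCountable n₀ k =
        P.gal n₀ ((thetaRayFreeProP p n).brHom b w hb u))
    (β : (((thetaRayFreeProP p n).galoisLevelData h36).tree N').Branch)
    (hβ : (((thetaRayFreeProP p n).galoisLevelData h36).tree N').abuts β = some (P.vertex N'))
    (hfix : (((thetaRayFreeProP p n).galoisLevelData h36).treeAct h36.isCountable N' g).hom.branchMap β = β) :
    ∃ (w' : ℕ) (P' : ((thetaRayFreeProP p n).galoisLevelData h36).PointSeq h36.isCountable w')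
      (b' : ℕ × Bool) (hb' : SemiGraph.ray.abuts b' = some w') (l' : Multiplicative ℤ_[p]) (y' : Grp p),
      y' = (thetaRayFreeProP p n).brHom b' w' hb' l' ∧ ‖(p : ℤ_[p]) ^ m‖ ≤ ‖l'.toAdd‖ ∧
      ((thetaRayFreeProP p n).galoisLevelData h36).proj h36.isCountable N' g = P'.gal N' y' ∧
      (∀ k ∈ K, ∃ u : Multiplicative ℤ_[p],
        ((thetaRayFreeProP p n).galoisLevelData h36).proj h36.isCountable n₀ k =
          P'.gal n₀ ((thetaRayFreeProP p n).brHom b' w' hb' u)) ∧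
      (((thetaRayFreeProP p n).galoisLevelData h36).tree N').Joins
          ((((thetaRayFreeProP p n).galoisLevelData h36).tree N').edgeOf β) (P.vertex N') (P'.vertex N') ∧
      P.vertex N' ≠ P'.vertex N' := by
  classical
  let Dg := (thetaRayFreeProP p n).galoisLevelData h36
  have hc36 := h36.isCountable
  -- the base branch of `β` and its partner
  set bβ : ℕ × Bool := (Dg.treeProj N').branchMap β with hbβ_def
  have hbβ : SemiGraph.ray.abuts bβ = some w := by
    have h1 := (Dg.treeProj N').abuts_branchMap β (P.vertex N') hβ
    rw [P.treeProj_vertexMap_vertex N'] at h1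
    exact h1
  set bβ' : ℕ × Bool := (bβ.1, !bβ.2) with hbβ'_def
  have hbb' : bβ ≠ bβ' := by
    intro h
    have := congrArg Prod.snd h
    cases hs : bβ.2 <;> simp [hbβ'_def, hs] at this
  set w' : ℕ := (if bβ.2 then bβ.1 else bβ.1 + 1) with hw'_def
  have hb' : SemiGraph.ray.abuts bβ' = some w' := ray_abuts_not bβ
  -- TRANSPORT across `β`
  obtain ⟨P', f', k', hframe', halign, hjoins, hne'⟩ :=
    P.exists_transport_of_branchMap_eq SemiGraph.ray_isConnected N' g bβ hbβ bβ' hbb' rfl w' hb' β rfl hβ hfix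
  -- everything read in `Grp p`
  set fG : Grp p := f' with hfG
  let brβ : Multiplicative ℤ_[p] →* Grp p :=
    (MonoidHom.id (Grp p)).comp ((thetaRayFreeProP p n).brHom bβ w hbβ).toMonoidHom
  let brβ' : Multiplicative ℤ_[p] →* Grp p :=
    (MonoidHom.id (Grp p)).comp ((thetaRayFreeProP p n).brHom bβ' w' hb').toMonoidHom
  let brb : Multiplicative ℤ_[p] →* Grp p :=
    (MonoidHom.id (Grp p)).comp ((thetaRayFreeProP p n).brHom b w hb).toMonoidHom
  have hbrβ : ∀ t, brβ t = (thetaRayFreeProP p n).brHom bβ w hbβ t := fun t => rfl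
  have hbrβ' : ∀ t, brβ' t = (thetaRayFreeProP p n).brHom bβ' w' hb' t := fun t => rfl
  have hbrb : ∀ t, brb t = (thetaRayFreeProP p n).brHom b w hb t := fun t => rfl
  have hframeG : Dg.proj hc36 N' g = P.gal N' (fG * brβ k' * fG⁻¹) := hframe'
  have halignG : ∀ t : Multiplicative ℤ_[p], P'.decompHom (brβ' t) = P.decompHom (fG * brβ t * fG⁻¹) :=
    fun t => halign t
  -- the group homomorphisms `ψ_n := ρ_n ∘ ψ_P`
  let ψn : Grp p →* Dg.Gal hc36 n₀ := (Dg.proj hc36 n₀).comp P.decompHom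
  have hψn : ∀ z : Grp p, P.gal n₀ z = ψn z := fun z => rfl
  -- FRAME SHIFT at `P.vertex N'`: `fG = b_*(π) · v`
  have hcmp : P.gal N' (fG * brβ k' * fG⁻¹) = P.gal N' ((1 : Grp p) * y * (1 : Grp p)⁻¹) := by
    rw [one_mul, inv_one, mul_one, ← hI1]
    exact hframeG.symm
  obtain ⟨π, yπ, v, hyπ, hv, hf'⟩ := hshift w P bβ b hbβ hb fG 1 (brβ k') y k' l hl (hbrβ k') hy hcmp
  rw [inv_one, one_mul] at hf'
  have hyπ' : yπ = brb π := hyπ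
  -- the new frame
  refine ⟨w', P', bβ', hb', k', brβ' k', hbrβ' k', ?_, ?_, ?_, hjoins, hne'⟩
  · -- `‖p^m‖ ≤ ‖k'‖`: order bookkeeping at the FIXED level `n₀` (the vertex `w` is far there)
    have hproj : P.gal n₀ (fG * brβ k' * fG⁻¹) = Dg.proj hc36 n₀ g := by
      rw [hψn]
      change Dg.proj hc36 n₀ (P.decompHom (fG * brβ k' * fG⁻¹)) = Dg.proj hc36 n₀ g
      rw [← Dg.mapLE_proj hc36 hnN (P.decompHom _), ← Dg.mapLE_proj hc36 hnN g, hframeG]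
      rfl
    -- the frame homomorphism `φ : t ↦ σ_{n₀}^{f b_*(t) f⁻¹}`
    set y₁ : Grp p := (thetaRayFreeProP p n).brHom bβ w hbβ (ofAdd (1 : ℤ_[p])) with hy₁
    let φ : Multiplicative ℤ_[p] →* Dg.Gal hc36 n₀ :=
      ψn.comp ((MulAut.conj fG).toMonoidHom.comp ((thetaRayFreeProP p n).brHom bβ w hbβ).toMonoidHom)
    have hconjc : Continuous (fun x : Grp p => fG * x * fG⁻¹) :=
      (continuous_const.mul continuous_id).mul continuous_const
    have hφc : Continuous φ :=
      ((Dg.continuous_proj hc36 n₀).comp P.continuous_decompHom).comp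
        (hconjc.comp ((thetaRayFreeProP p n).brHom bβ w hbβ).continuous)
    have hz : ∀ t, φ t ∈ Subgroup.zpowers (φ (ofAdd 1)) := fun t =>
      mem_zpowers_map_of_dense (ofAdd (1 : ℤ_[p])) PadicInt.topologicalClosure_zpowers_ofAdd_one φ hφc t
    have hconj : orderOf (φ (ofAdd 1)) = orderOf (P.gal n₀ y₁) := by
      have e1 : φ (ofAdd 1) = ψn fG * ψn y₁ * (ψn fG)⁻¹ := by
        have h0 : φ (ofAdd 1) = ψn (fG * y₁ * fG⁻¹) := rfl
        rw [h0, map_mul, map_mul, map_inv]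
      rw [e1]
      exact (MulAut.conj (ψn fG)).orderOf_eq (ψn y₁)
    have he₁ : orderOf (P.gal n₀ y₁) = p ^ e₀ := hfarord w hw₂ bβ hbβ P
    have hφk : φ k' = Dg.proj hc36 n₀ g := by
      have h0 : φ k' = ψn (fG * brβ k' * fG⁻¹) := rfl
      rw [h0, ← hψn]
      exact hproj
    exact PadicInt.norm_pow_le_norm_of_orderOf_eq p φ hz (hconj.trans he₁) m hm k' (by rw [hφk]; exact horder)
  · -- (I1) at `P'`: alignment of the transport
    rw [← P'.proj_decompHom, halignG k', P.proj_decompHom]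
    exact hframeG
  · -- (I2_K) at `P'`
    intro k hk
    obtain ⟨u, hu⟩ := hI2 k hk
    refine ⟨u, ?_⟩
    rw [← P'.proj_decompHom, ← hbrβ' u, halignG u, P.proj_decompHom]
    -- `P.gal n₀ (fG · b_*(u) · fG⁻¹) = ρ_{n₀}(k)` with `fG = yπ · v`
    have hvn : ψn v = 1 := by rw [← hψn]; exact hV w P v hv
    -- the two branch values at `w` agree modulo `G(d)`
    set yu : Grp p := (thetaRayFreeProP p n).brHom b w hb u with hyu
    obtain ⟨t, ht, hybu_eq⟩ := thetaRayFreeProP_brHom_congr_of_twist p n d (htwist w hw₁) bβ b hbβ hb u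
      (brβ u) yu (hbrβ u) hyu
    have htn : ψn t = 1 := by rw [← hψn]; exact hV w P t ht
    have hyu' : yu = brb u := hyu
    -- `yπ · yu · yπ⁻¹ = yu` (the edge group is commutative)
    have hcomm : yπ * yu * yπ⁻¹ = yu := by
      rw [hyπ', hyu', ← map_mul, ← map_inv, ← map_mul, mul_inv_cancel_comm]
    have e1 : ψn (fG * brβ u * fG⁻¹) = ψn fG * ψn (brβ u) * (ψn fG)⁻¹ := by
      rw [map_mul, map_mul, map_inv]
    have e2 : ψn fG = ψn yπ * ψn v := by rw [hf', map_mul]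
    have e3 : ψn (brβ u) = ψn t * ψn yu := by rw [hybu_eq, map_mul]
    change Dg.proj hc36 n₀ k = ψn (fG * brβ u * fG⁻¹)
    rw [e1, e2, e3, hvn, htn, mul_one, one_mul, ← map_mul, ← map_inv, ← map_mul, hcomm, ← hψn]
    exact hu

/-! ### The general frame induction -/

/-- **THE GENERAL INDUCTION along a `g`-fixed path of the deep tree**: the invariant of
`thetaRayFreeProP_frame_step_gen` propagates from `P.vertex N'` to the end vertex `yy` of any path of the
subdivision of `𝔾̃_{N'}` whose end vertex is fixed by `g` (then all its nodes are), provided every `g`-fixed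
vertex of `𝔾̃_{N'}` is far for the shallow level `n₀`. [cite: MochizukiSemiAnbd2006, Thm 3.7(iv) p.41] -/
theorem thetaRayFreeProP_frame_induction_gen (h36 : (thetaRayFreeProP p n).Prop36Hypotheses)
    (g : ((thetaRayFreeProP p n).galoisLevelData h36).temperedPi h36.isCountable)
    (K : Set (((thetaRayFreeProP p n).galoisLevelData h36).temperedPi h36.isCountable))
    (m N' : ℕ) {n₀ : ℕ} (hnN : n₀ ≤ N') (e₀ : ℕ) (hm : m < e₀)
    (horder : orderOf (((thetaRayFreeProP p n).galoisLevelData h36).proj h36.isCountable n₀ g) = p ^ (e₀ - m))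
    (d : ℕ)
    (hV : ∀ (w : ℕ) (P : ((thetaRayFreeProP p n).galoisLevelData h36).PointSeq h36.isCountable w) (v : Grp p),
      v ∈ charOpenCore (Grp p) d → P.gal n₀ v = 1)
    (k₁ : ℕ) (htwist : ∀ k, k₁ ≤ k → ∀ x : Grp p, θ p (n k) x * x⁻¹ ∈ charOpenCore (Grp p) d)
    (F₀ : ℕ) (hfarord : ∀ w, F₀ ≤ w → ∀ (b : ℕ × Bool) (hb : SemiGraph.ray.abuts b = some w)
      (P : ((thetaRayFreeProP p n).galoisLevelData h36).PointSeq h36.isCountable w),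
      orderOf (P.gal n₀ ((thetaRayFreeProP p n).brHom b w hb (ofAdd (1 : ℤ_[p])))) = p ^ e₀)
    (hshift : ∀ (w : ℕ) (P : ((thetaRayFreeProP p n).galoisLevelData h36).PointSeq h36.isCountable w)
      (b₁ b₂ : ℕ × Bool) (hb₁ : SemiGraph.ray.abuts b₁ = some w) (hb₂ : SemiGraph.ray.abuts b₂ = some w)
      (f₁ f₂ y₁ y₂ : Grp p) (k k₂ : Multiplicative ℤ_[p]), ‖(p : ℤ_[p]) ^ m‖ ≤ ‖k₂.toAdd‖ →
      y₁ = (thetaRayFreeProP p n).brHom b₁ w hb₁ k → y₂ = (thetaRayFreeProP p n).brHom b₂ w hb₂ k₂ →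
      P.gal N' (f₁ * y₁ * f₁⁻¹) = P.gal N' (f₂ * y₂ * f₂⁻¹) →
      ∃ (π : Multiplicative ℤ_[p]) (y v : Grp p), y = (thetaRayFreeProP p n).brHom b₂ w hb₂ π ∧
        v ∈ charOpenCore (Grp p) d ∧ f₂⁻¹ * f₁ = y * v)
    (hfarx : ∀ y : (((thetaRayFreeProP p n).galoisLevelData h36).tree N').Vertex,
      (((thetaRayFreeProP p n).galoisLevelData h36).treeAct h36.isCountable N' g).hom.vertexMap y = y →
        k₁ ≤ (((thetaRayFreeProP p n).galoisLevelData h36).treeProj N').vertexMap y ∧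
        F₀ ≤ (((thetaRayFreeProP p n).galoisLevelData h36).treeProj N').vertexMap y) :
    ∀ (L : ℕ) {w : ℕ} (P : ((thetaRayFreeProP p n).galoisLevelData h36).PointSeq h36.isCountable w)
      (b : ℕ × Bool) (hb : SemiGraph.ray.abuts b = some w) (l : Multiplicative ℤ_[p]) (y : Grp p),
      y = (thetaRayFreeProP p n).brHom b w hb l → ‖(p : ℤ_[p]) ^ m‖ ≤ ‖l.toAdd‖ →
      ((thetaRayFreeProP p n).galoisLevelData h36).proj h36.isCountable N' g = P.gal N' y →
      (∀ k ∈ K, ∃ u : Multiplicative ℤ_[p],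
        ((thetaRayFreeProP p n).galoisLevelData h36).proj h36.isCountable n₀ k =
          P.gal n₀ ((thetaRayFreeProP p n).brHom b w hb u)) →
      ∀ (yy : (((thetaRayFreeProP p n).galoisLevelData h36).tree N').Vertex)
        (q : (((thetaRayFreeProP p n).galoisLevelData h36).tree N').subdivision.Walk (Sum.inl (P.vertex N'))
          (Sum.inl yy)), q.IsPath → q.length ≤ L →
        (((thetaRayFreeProP p n).galoisLevelData h36).treeAct h36.isCountable N' g).hom.vertexMap yy = yy →
        ∃ (w' : ℕ) (P' : ((thetaRayFreeProP p n).galoisLevelData h36).PointSeq h36.isCountable w')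
          (b' : ℕ × Bool) (hb' : SemiGraph.ray.abuts b' = some w') (l' : Multiplicative ℤ_[p]) (y' : Grp p),
          y' = (thetaRayFreeProP p n).brHom b' w' hb' l' ∧ ‖(p : ℤ_[p]) ^ m‖ ≤ ‖l'.toAdd‖ ∧
          ((thetaRayFreeProP p n).galoisLevelData h36).proj h36.isCountable N' g = P'.gal N' y' ∧
          (∀ k ∈ K, ∃ u : Multiplicative ℤ_[p],
            ((thetaRayFreeProP p n).galoisLevelData h36).proj h36.isCountable n₀ k =
              P'.gal n₀ ((thetaRayFreeProP p n).brHom b' w' hb' u)) ∧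
          P'.vertex N' = yy := by
  classical
  let Dg := (thetaRayFreeProP p n).galoisLevelData h36
  have hc36 := h36.isCountable
  have hT := (Dg.isTree_tree N').isTree
  intro L
  induction L with
  | zero =>
    intro w P b hb l y hy hl hI1 hI2 yy q hq hL hyy
    have h0 : q.length = 0 := Nat.le_zero.mp hL
    have hend : Sum.inl (P.vertex N') = (Sum.inl yy : (Dg.tree N').Node) := by
      have h1 := q.getVert_length
      rw [h0, q.getVert_zero] at h1
      exact h1
    exact ⟨w, P, b, hb, l, y, hy, hl, hI1, hI2, Sum.inl_injective hend⟩
  | succ L ih =>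
    intro w P b hb l y hy hl hI1 hI2 yy q hq hL hyy
    by_cases hlen : q.length = 0
    · have hend : Sum.inl (P.vertex N') = (Sum.inl yy : (Dg.tree N').Node) := by
        have h1 := q.getVert_length
        rw [hlen, q.getVert_zero] at h1
        exact h1
      exact ⟨w, P, b, hb, l, y, hy, hl, hI1, hI2, Sum.inl_injective hend⟩
    -- all nodes of `q` are fixed by `g`
    set σ := Dg.treeAct hc36 N' g with hσ
    have hstart : σ.hom.vertexMap (P.vertex N') = P.vertex N' :=
      treeAct_vertexMap_vertex_of_proj_eq p n h36 P N' g y hI1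
    have hall : ∀ z ∈ q.support, SemiGraph.nodeMap σ z = z :=
      SemiGraph.nodeMap_eq_self_of_isPath hT.isAcyclic σ (by simp [hstart]) (by simp [hyy]) q hq
    -- the first four nodes: `P.vertex N' – β – e – β' – v₁`
    have hx0 : q.getVert 0 = Sum.inl (P.vertex N') := q.getVert_zero
    have h0n : 0 < q.length := Nat.pos_of_ne_zero hlen
    obtain ⟨β, hβ, hx1⟩ := SemiGraph.step_vertex q h0n hx0
    have h1n : 1 < q.length := SemiGraph.lt_length_of_getVert_ne q h0n (by rw [hx1]; simp)
    have hx2 : q.getVert 2 = Sum.inr (Sum.inl ((Dg.tree N').edgeOf β)) := by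
      rcases SemiGraph.step_branch q h1n hx1 with h | ⟨v, hv, h⟩
      · exact h
      · exfalso
        have hvw : v = P.vertex N' := by rw [hβ] at hv; exact (Option.some.inj hv).symm
        exact SemiGraph.getVert_add_two_ne q hq (i := 0) (by omega) (by rw [h, hx0, hvw])
    have h2n : 2 < q.length := SemiGraph.lt_length_of_getVert_ne q h1n (by rw [hx2]; simp)
    obtain ⟨β', hβ'e, hx3⟩ := SemiGraph.step_edge q h2n hx2
    have hββ' : β' ≠ β := by
      intro h
      exact SemiGraph.getVert_add_two_ne q hq (i := 1) (by omega) (by rw [hx3, hx1, h])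
    have h3n : 3 < q.length := SemiGraph.lt_length_of_getVert_ne q h2n (by rw [hx3]; simp)
    obtain ⟨v₁, hβ'v, hx4⟩ : ∃ v₁ : (Dg.tree N').Vertex, (Dg.tree N').abuts β' = some v₁ ∧
        q.getVert 4 = Sum.inl v₁ := by
      rcases SemiGraph.step_branch q h3n hx3 with h | h
      · exfalso
        exact SemiGraph.getVert_add_two_ne q hq (i := 2) (by omega) (by rw [h, hx2, hβ'e])
      · exact h
    -- `g` fixes `β`
    have hfixβ : σ.hom.branchMap β = β := by
      have h1 := hall (q.getVert 1) (q.getVert_mem_support 1)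
      rw [hx1] at h1
      simpa only [SemiGraph.nodeMap_inr_inr, Sum.inr.injEq] using h1
    -- the current vertex is far for the shallow level
    obtain ⟨hw₁, hw₂⟩ : k₁ ≤ w ∧ F₀ ≤ w := by
      have h1 := hfarx (P.vertex N') hstart
      rw [P.treeProj_vertexMap_vertex N'] at h1
      exact h1
    -- THE STEP
    obtain ⟨w', P', b', hb', l', y', hy', hl', hI1', hI2', hjoins, hneq⟩ :=
      thetaRayFreeProP_frame_step_gen p n h36 g K m N' hnN e₀ hm horder d hV k₁ htwist F₀ hfarord hshift hw₁ hw₂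
        P b hb l y hy hl hI1 hI2 β hβ hfixβ
    -- the vertex reached is `v₁`
    have hv₁ : P'.vertex N' = v₁ := by
      obtain ⟨β₁, β₂, hβne, hβ₁e, hβ₂e, hβ₁a, hβ₂a⟩ := hjoins
      have hβ₁β : β₁ = β := SemiGraph.branch_unique_of_isAcyclic hT.isAcyclic hβ₁e hβ₁a hβ
      have hβ₂β' : β₂ = β' :=
        SemiGraph.branch_eq_of_ne_of_ne rfl hβ₂e hβ'e (by rw [← hβ₁β]; exact hβne.symm) hββ'
      rw [hβ₂β', hβ'v] at hβ₂a
      exact (Option.some.inj hβ₂a).symm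
    -- the remaining path from `v₁`
    have hx4' : q.getVert 4 = Sum.inl (P'.vertex N') := by rw [hx4, hv₁]
    let q' : (Dg.tree N').subdivision.Walk (Sum.inl (P'.vertex N')) (Sum.inl yy) := (q.drop 4).copy hx4' rfl
    have hq' : q'.IsPath := by
      simp only [q', SimpleGraph.Walk.isPath_copy]
      exact hq.drop 4
    have hL' : q'.length ≤ L := by
      simp only [q', SimpleGraph.Walk.length_copy, SimpleGraph.Walk.drop_length]
      omega
    exact ih P' b' hb' l' y' hy' hl' hI1' hI2' yy q' hq' hL' hyy

end ProfiniteSemiGraph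

end Literature.AnabelianGeometry.SemiGraphs

end
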